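import Literature.AnabelianGeometry.EtaleTheta.ClassicalThetaSimpleZeros
import Mathlib.RingTheory.LaurentSeries
import Mathlib.Topology.Algebra.Valued.NormedValued
import Mathlib.RingTheory.Valuation.Discrete.RankOne
import Mathlib.GroupTheory.SpecificGroups.Cyclic
import Mathlib.Algebra.Field.ZMod
import HarnessLib

/-!
# [EtTh] Prop. 1.4 (i), simple zeros: `ThetaDdotSimpleZeros'` DISCHARGED; the first typing REFUTED (char. 2)

Mochizuki, *The étale theta function and its Frobenioid-theoretic manifestations*, Publ. RIMS **45**
(2009) 227–349 [cite: MochizukiEtTh2009, Prop 1.4 (i) p.21] (PRIMS PDF p. 21 = printed p. 247). Layer L2 of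
the abc-iut cell, wave-2 unit W2-L2-02 (seat abc-iut-L2-t6); sequel to `ClassicalThetaSimpleZeros.lean`.

* `ThetaDdotSimpleZeros'_holds : ThetaDdotSimpleZeros'` — DISCHARGE of the corrected named fact of
  `ClassicalTheta.lean` ("each zero of `Θ̈` has multiplicity 1", for complete nontrivially normed
  ultrametric fields with `(2 : L) ≠ 0`, the paper's `K̈ ⊇ ℚ_p`), by `deriv_thetaDdot_cusp_ne_zero`.
* `not_thetaDdotSimpleZeros : ¬ ThetaDdotSimpleZeros` — the fact as FIRST typed (no hypothesis on the
  characteristic) is false: in characteristic `2` the cusps `Ü = 1` and `Ü = -1` coincide and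
  `Θ̈'(1) = 2 H(1) = 0` (`deriv_thetaDdot_one_eq_zero_of_two_eq_zero`). WITNESS: `L = 𝔽₂((X))`, i.e.
  Mathlib's `LaurentSeries (ZMod 2)` with its `X`-adic valuation (`Valued` instance, complete by
  `LaurentSeries.instLaurentSeriesComplete`), made a nontrivially normed field by a rank-one structure on
  the valuation (`Valuation.IsRankOneDiscrete.rankOne`, `Valued.toNontriviallyNormedField`); the norm is
  ultrametric and `2 = 0` there. All these instances are local to the proof (nothing is registered
  globally on Mathlib's types).

This refutes ONLY our first, over-general typing (acknowledged in the docstring of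
`ThetaDdotSimpleZeros'` in `ClassicalTheta.lean`); the statement the paper makes is the primed one, now
PROVED. HONEST FRAMING: no disputed claim is touched; Prop. 1.4 is classical.
-/

namespace Literature.AnabelianGeometry.EtaleTheta

/-! ### The corrected fact, discharged -/

/-- **DISCHARGE of the named fact `ThetaDdotSimpleZeros'`** (`ClassicalTheta.lean`: Prop. 1.4 (i), "each
zero has multiplicity 1", over complete nonarchimedean fields with `(2 : L) ≠ 0`): PROVED, by
`deriv_thetaDdot_cusp_ne_zero` of `ClassicalThetaSimpleZeros.lean`. [cite: MochizukiEtTh2009, Prop 1.4 (i) p.21] -/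
theorem ThetaDdotSimpleZeros'_holds : ThetaDdotSimpleZeros' :=
  fun _L _ _ _ _q2 h2 hq0 hq a => deriv_thetaDdot_cusp_ne_zero h2 hq0 hq a

/-! ### A characteristic-2 witness: `𝔽₂((X))`; hence `¬ ThetaDdotSimpleZeros` -/

section CharTwo

open scoped LaurentSeries WithZero

/-- The `X`-adic valuation of a Laurent-series field `K((X))` is nontrivial (`v(X) = exp(-1) ∉ {0, 1}`).
(Elementary; auxiliary for the refutation below.) [cite: MochizukiEtTh2009, Prop 1.4 (i) p.21] -/
theorem laurentSeries_valuation_isNontrivial (K : Type*) [Field K] :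
    (Valued.v : Valuation K⸨X⸩ ℤᵐ⁰).IsNontrivial := by
  refine ⟨HahnSeries.single 1 1, ?_, ?_⟩ <;> rw [LaurentSeries.valuation_single_zpow]
  · exact WithZero.exp_ne_zero
  · rw [Ne, WithZero.exp_eq_one]
    norm_num

/-- `2 = 0` in `𝔽₂((X))`. (Elementary; auxiliary for the refutation below.)
[cite: MochizukiEtTh2009, Prop 1.4 (i) p.21] -/
theorem laurentSeries_zmod_two_two_eq_zero : (2 : (ZMod 2)⸨X⸩) = 0 := by
  rw [← map_ofNat (algebraMap (ZMod 2) (ZMod 2)⸨X⸩) 2, show (2 : ZMod 2) = 0 from rfl, map_zero]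

/-- **`ThetaDdotSimpleZeros` as typed in `ClassicalTheta.lean` is FALSE**: the field `𝔽₂((X))`
(`LaurentSeries (ZMod 2)`, complete for the `X`-adic valuation, normed via a rank-one structure on that
valuation) is a complete nontrivially normed ultrametric field with `2 = 0`, where `Θ̈'(1) = 0`
(`deriv_thetaDdot_one_eq_zero_of_two_eq_zero`). This refutes ONLY the over-general typing (no
characteristic hypothesis); Prop. 1.4 (i) itself concerns `K̈ ⊇ ℚ_p` and is PROVED in that generality as
`thetaDdotSimpleZeros_of_two_ne_zero`. [cite: MochizukiEtTh2009, Prop 1.4 (i) p.21] -/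
theorem not_thetaDdotSimpleZeros : ¬ ThetaDdotSimpleZeros := by
  intro h
  haveI := laurentSeries_valuation_isNontrivial (ZMod 2)
  letI hr : (Valued.v : Valuation (ZMod 2)⸨X⸩ ℤᵐ⁰).RankOne :=
    Valuation.IsRankOneDiscrete.rankOne Valued.v one_lt_two
  letI hn : NontriviallyNormedField (ZMod 2)⸨X⸩ := Valued.toNontriviallyNormedField (ZMod 2)⸨X⸩ ℤᵐ⁰
  haveI : IsUltrametricDist (ZMod 2)⸨X⸩ :=
    IsUltrametricDist.isUltrametricDist_of_forall_norm_add_le_max_norm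
      fun x y => Valuation.norm_add_le _ x y
  haveI : CompleteSpace (ZMod 2)⸨X⸩ := LaurentSeries.instLaurentSeriesComplete
  exact two_ne_zero_of_thetaDdotSimpleZeros h (ZMod 2)⸨X⸩ laurentSeries_zmod_two_two_eq_zero

end CharTwo

end Literature.AnabelianGeometry.EtaleTheta
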